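import Literature.Probability.RandomPlanarGeometry.HexParafermion
import Literature.Probability.RandomPlanarGeometry.HexSAWLattice
import Literature.Probability.LatticeModels.TriangularLatticeProofs
import Literature.Probability.Percolation.SitePaths
import HarnessLib

/-!
# One-vertex hexagonal-lattice domains are simply connected; distinct vertices of `ℍ` are `≥ 1/√3` apart

Topic `Literature/Probability/RandomPlanarGeometry` (namespace `….SAW`, next to
`hexDomainSimplyConnected` of `HexParafermion.lean`).  Two elementary lattice facts used when
the Duminil-Copin–Smirnov items (`∀ Λ, hexDomainSimplyConnected Λ → …`, e.g. Lemma 1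
`DuminilCopinSmirnov2012_lemma1`, and the route items of `CriticalPhenomena/SAWScalingLimit`)
are instantiated at a concrete domain:

* **`hexDomainSimplyConnected_singleton v`** — for every vertex `v` of the hexagonal lattice the
  domain `{v}` is simply connected, i.e. (definition in `HexParafermion.lean`: "having a connected
  complement") the subgraph of `ℍ = hexGraph` induced on the complement of `v` is preconnected.
  Proof (coordinates `(x, i)`, `x : Site 2`, `i : Fin 2`, adjacency `hexGraph_adj_iff_coord`):
  the zigzag ray `(a,b;0) ∼ (a,b;1) ∼ (a+1,b;0) ∼ ⋯` in the `+e₀` direction avoids `v = (c; s)`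
  from every "good" start (second coordinate `≠ c₁`, or first coordinate `> c₀`, or the down-face
  at abscissa `c₀` when `v` is the up-face); every other vertex of the complement becomes good after
  one vertical step; at an abscissa `N > c₀` vertical double steps join all rays to the hub
  `(N,0;0)`.  Paths are `Literature.Probability.Percolation.PathIn` chains, turned into
  preconnectedness of the induced subgraph by `preconnected_induce_of_forall_pathIn` (generic).
* **`inv_sqrt_three_le_dist_hexCenter`** — `w ≠ v → 1/√3 ≤ dist (hexCenter w) (hexCenter v)`:
  the honeycomb edge length is the minimal distance (the quadratic form `a² + ab + b²` of `𝕋`,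
  `normSq_add_mul_triZeta`, on the two sublattices; integrality gives the bound).

Deliberately NOT here: simple connectivity of larger domains (balls, polyhexes, strips) — the same
ray/hub scheme applies but needs a description of the domain's shadow on each ray.
-/

namespace Literature.Probability.RandomPlanarGeometry.SAW

open Literature.Probability.LatticeModels Literature.Probability.Percolation

/-! ### From paths inside a set to preconnectedness of the induced subgraph -/

/-- Paths inside a set of vertices (`PathIn`) between any two of its points make the induced
subgraph preconnected (generic form of the `triGraph` statement
`Literature.Probability.Percolation.preconnected_induce_of_pathIn`). [folklore] -/
theorem preconnected_induce_of_forall_pathIn {V : Type*} {G : SimpleGraph V} {S : Set V}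
    (h : ∀ x ∈ S, ∀ y ∈ S, PathIn G S x y) : (G.induce S).Preconnected := by
  rintro ⟨x, hx⟩ ⟨y, hy⟩
  obtain ⟨-, hR⟩ := h x hx y hy
  revert hy
  induction hR with
  | refl => intro _; exact SimpleGraph.Reachable.refl _
  | @tail b c hxb hbc ih =>
    intro hc
    have hb : b ∈ S := PathIn.right_mem (G := G) (show PathIn G S x b from ⟨hx, hxb⟩)
    exact (ih hb).trans (SimpleGraph.Adj.reachable
      (show (G.induce S).Adj ⟨b, hb⟩ ⟨c, hc⟩ from SimpleGraph.induce_adj.2 hbc.1))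

/-! ### The four lattice moves in coordinates -/

/-- Up-face to down-face of the same cell. [folklore] -/
theorem hexGraph_adj_up (a b : ℤ) : hexGraph.Adj (![a, b], 0) (![a, b], 1) := by
  rw [hexGraph_adj_iff_coord]; simp

/-- Down-face of the cell `x` to the up-face of `x + e₀`. [folklore] -/
theorem hexGraph_adj_e0 (a b : ℤ) : hexGraph.Adj (![a, b], 1) (![a + 1, b], 0) := by
  rw [hexGraph_adj_iff_coord]; simp

/-- Up-face of the cell `x` to the down-face of `x - e₁`. [folklore] -/
theorem hexGraph_adj_dn (a b : ℤ) : hexGraph.Adj (![a, b], 0) (![a, b - 1], 1) := by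
  rw [hexGraph_adj_iff_coord]; simp

/-- Down-face of the cell `x` to the up-face of `x + e₁`. [folklore] -/
theorem hexGraph_adj_e1 (a b : ℤ) : hexGraph.Adj (![a, b], 1) (![a, b + 1], 0) := by
  rw [hexGraph_adj_iff_coord]; simp

/-! ### The complement of one vertex is connected -/

section Singleton

variable (c : Site 2) (s : Fin 2)

/-- Membership in the complement of the one-vertex domain `{(c; s)}`, in coordinates. [folklore] -/
theorem mem_compl_singleton_iff (a b : ℤ) (i : Fin 2) :
    ((![a, b] : Site 2), i) ∈ ((↑({(c, s)} : Finset HexVertex) : Set HexVertex))ᶜ ↔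
      ¬ (a = c 0 ∧ b = c 1 ∧ i = s) := by
  have hc : c = ![c 0, c 1] := by funext j; fin_cases j <;> rfl
  simp only [Finset.coe_singleton, Set.mem_compl_iff, Set.mem_singleton_iff, Prod.mk.injEq,
    not_iff_not]
  constructor
  · rintro ⟨h1, h2⟩
    exact ⟨by simpa using congrFun h1 0, by simpa using congrFun h1 1, h2⟩
  · rintro ⟨rfl, rfl, rfl⟩
    exact ⟨hc.symm, rfl⟩

/-- Good start points of the `+e₀` ray lie in the complement. [folklore] -/
theorem mem_compl_singleton_of_good (a b : ℤ) (i : Fin 2)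
    (h : b ≠ c 1 ∨ c 0 < a ∨ (a = c 0 ∧ s = 0 ∧ i = 1)) :
    ((![a, b] : Site 2), i) ∈ ((↑({(c, s)} : Finset HexVertex) : Set HexVertex))ᶜ := by
  rw [mem_compl_singleton_iff]
  rintro ⟨h1, h2, h3⟩
  rcases h with h | h | ⟨-, h4, h5⟩
  · exact h h2
  · omega
  · rw [h5] at h3; rw [← h3] at h4; exact absurd h4 (by decide)

/-- Vertices off the abscissa of the removed vertex lie in the complement. [folklore] -/
theorem mem_compl_singleton_of_ne (a b : ℤ) (i : Fin 2) (h : a ≠ c 0) :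
    ((![a, b] : Site 2), i) ∈ ((↑({(c, s)} : Finset HexVertex) : Set HexVertex))ᶜ := by
  rw [mem_compl_singleton_iff]
  rintro ⟨h1, -, -⟩
  exact h h1

/-- One zigzag step to the right from a good point, inside the complement, staying good. [folklore] -/
theorem pathIn_compl_singleton_step (a b : ℤ) (i : Fin 2)
    (h : b ≠ c 1 ∨ c 0 < a ∨ (a = c 0 ∧ s = 0 ∧ i = 1)) :
    PathIn hexGraph ((↑({(c, s)} : Finset HexVertex) : Set HexVertex))ᶜ (![a, b], i) (![a + 1, b], i) ∧
      (b ≠ c 1 ∨ c 0 < a + 1 ∨ (a + 1 = c 0 ∧ s = 0 ∧ i = 1)) := by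
  have hmem := mem_compl_singleton_of_good c s a b i h
  have hgood' : b ≠ c 1 ∨ c 0 < a + 1 ∨ (a + 1 = c 0 ∧ s = 0 ∧ i = 1) := by
    rcases h with h | h | ⟨h1, -, -⟩
    · exact Or.inl h
    · exact Or.inr (Or.inl (by omega))
    · exact Or.inr (Or.inl (by omega))
  refine ⟨?_, hgood'⟩
  fin_cases i
  · -- (a,b;0) → (a,b;1) → (a+1,b;0)
    have hmid : ((![a, b] : Site 2), (1 : Fin 2)) ∈ ((↑({(c, s)} : Finset HexVertex) : Set HexVertex))ᶜ := by
      rcases h with h | h | ⟨-, -, h5⟩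
      · exact mem_compl_singleton_of_good c s a b 1 (Or.inl h)
      · exact mem_compl_singleton_of_ne c s a b 1 (by omega)
      · exact absurd h5 (by decide)
    have hend : ((![a + 1, b] : Site 2), (0 : Fin 2)) ∈ ((↑({(c, s)} : Finset HexVertex) : Set HexVertex))ᶜ := by
      rcases h with h | h | ⟨h1, -, -⟩
      · exact mem_compl_singleton_of_good c s (a + 1) b 0 (Or.inl h)
      · exact mem_compl_singleton_of_ne c s (a + 1) b 0 (by omega)
      · exact mem_compl_singleton_of_ne c s (a + 1) b 0 (by omega)
    exact ((PathIn.refl hmem).tail (hexGraph_adj_up a b) hmid).tail (hexGraph_adj_e0 a b) hend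
  · -- (a,b;1) → (a+1,b;0) → (a+1,b;1)
    have hmid : ((![a + 1, b] : Site 2), (0 : Fin 2)) ∈ ((↑({(c, s)} : Finset HexVertex) : Set HexVertex))ᶜ := by
      rcases h with h | h | ⟨h1, -, -⟩
      · exact mem_compl_singleton_of_good c s (a + 1) b 0 (Or.inl h)
      · exact mem_compl_singleton_of_ne c s (a + 1) b 0 (by omega)
      · exact mem_compl_singleton_of_ne c s (a + 1) b 0 (by omega)
    exact ((PathIn.refl hmem).tail (hexGraph_adj_e0 a b) hmid).tail (hexGraph_adj_up (a + 1) b)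
      (mem_compl_singleton_of_good c s (a + 1) b 1 hgood')

/-- The zigzag ray: `n` steps to the right from a good point, inside the complement. [folklore] -/
theorem pathIn_compl_singleton_ray (n : ℕ) : ∀ (a b : ℤ) (i : Fin 2),
    (b ≠ c 1 ∨ c 0 < a ∨ (a = c 0 ∧ s = 0 ∧ i = 1)) →
    PathIn hexGraph ((↑({(c, s)} : Finset HexVertex) : Set HexVertex))ᶜ (![a, b], i) (![a + n, b], i) := by
  induction n with
  | zero => intro a b i h; simpa using PathIn.refl (mem_compl_singleton_of_good c s a b i h)
  | succ n ih =>
    intro a b i h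
    obtain ⟨h1, h2⟩ := pathIn_compl_singleton_step c s a b i h
    have h3 := ih (a + 1) b i h2
    have e : a + 1 + (n : ℤ) = a + ((n + 1 : ℕ) : ℤ) := by push_cast; ring
    rw [e] at h3
    exact h1.trans h3

/-- From any vertex of the complement, at most one vertical step reaches a good point. [folklore] -/
theorem pathIn_compl_singleton_to_good (a b : ℤ) (i : Fin 2)
    (hS : ((![a, b] : Site 2), i) ∈ ((↑({(c, s)} : Finset HexVertex) : Set HexVertex))ᶜ) :
    ∃ (a' b' : ℤ) (i' : Fin 2), (b' ≠ c 1 ∨ c 0 < a' ∨ (a' = c 0 ∧ s = 0 ∧ i' = 1)) ∧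
      PathIn hexGraph ((↑({(c, s)} : Finset HexVertex) : Set HexVertex))ᶜ (![a, b], i) (![a', b'], i') := by
  by_cases hg : b ≠ c 1 ∨ c 0 < a ∨ (a = c 0 ∧ s = 0 ∧ i = 1)
  · exact ⟨a, b, i, hg, PathIn.refl hS⟩
  · have hb : b = c 1 := by
      by_contra hb; exact hg (Or.inl hb)
    fin_cases i
    · refine ⟨a, b - 1, (1 : Fin 2), Or.inl (by omega), ?_⟩
      exact (PathIn.refl hS).tail (hexGraph_adj_dn a b)
        (mem_compl_singleton_of_good c s a (b - 1) 1 (Or.inl (by omega)))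
    · refine ⟨a, b + 1, (0 : Fin 2), Or.inl (by omega), ?_⟩
      exact (PathIn.refl hS).tail (hexGraph_adj_e1 a b)
        (mem_compl_singleton_of_good c s a (b + 1) 0 (Or.inl (by omega)))

/-- Vertical double steps at an abscissa other than that of the removed vertex. [folklore] -/
theorem pathIn_compl_singleton_vertical (a : ℤ) (ha : a ≠ c 0) (k : ℕ) (b : ℤ) :
    PathIn hexGraph ((↑({(c, s)} : Finset HexVertex) : Set HexVertex))ᶜ (![a, b + k], 0) (![a, b], 0) ∧
      PathIn hexGraph ((↑({(c, s)} : Finset HexVertex) : Set HexVertex))ᶜ (![a, b - k], 0) (![a, b], 0) := by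
  have hm : ∀ y : ℤ, ∀ j : Fin 2,
      ((![a, y] : Site 2), j) ∈ ((↑({(c, s)} : Finset HexVertex) : Set HexVertex))ᶜ :=
    fun y j => mem_compl_singleton_of_ne c s a y j ha
  induction k with
  | zero =>
    simp only [Nat.cast_zero, add_zero, sub_zero]
    exact ⟨PathIn.refl (hm b 0), PathIn.refl (hm b 0)⟩
  | succ k ih =>
    obtain ⟨ih1, ih2⟩ := ih
    constructor
    · have s1 : PathIn hexGraph ((↑({(c, s)} : Finset HexVertex) : Set HexVertex))ᶜ
          (![a, b + (k + 1 : ℕ)], 0) (![a, b + k], 0) := by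
        have e : b + ((k + 1 : ℕ) : ℤ) - 1 = b + k := by push_cast; ring
        have p := ((PathIn.refl (hm _ 0)).tail (hexGraph_adj_dn a (b + (k + 1 : ℕ))) (hm _ 1))
        rw [e] at p
        exact p.tail (hexGraph_adj_up a (b + k)).symm (hm _ 0)
      exact s1.trans ih1
    · have s1 : PathIn hexGraph ((↑({(c, s)} : Finset HexVertex) : Set HexVertex))ᶜ
          (![a, b - (k + 1 : ℕ)], 0) (![a, b - k], 0) := by
        have e : b - ((k + 1 : ℕ) : ℤ) + 1 = b - k := by push_cast; ring
        have p := ((PathIn.refl (hm _ 0)).tail (hexGraph_adj_up a (b - (k + 1 : ℕ))) (hm _ 1)).tail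
          (hexGraph_adj_e1 a (b - (k + 1 : ℕ))) (hm _ 0)
        rw [e] at p
        exact p
      exact s1.trans ih2

/-- Every vertex of the complement is joined, inside the complement, to the hub `(N, 0; 0)` for
all large `N`. [folklore] -/
theorem pathIn_compl_singleton_to_hub (a b : ℤ) (i : Fin 2)
    (hS : ((![a, b] : Site 2), i) ∈ ((↑({(c, s)} : Finset HexVertex) : Set HexVertex))ᶜ) :
    ∃ B : ℤ, ∀ N : ℤ, B ≤ N →
      PathIn hexGraph ((↑({(c, s)} : Finset HexVertex) : Set HexVertex))ᶜ (![a, b], i) (![N, 0], 0) := by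
  obtain ⟨a', b', i', hg, p1⟩ := pathIn_compl_singleton_to_good c s a b i hS
  refine ⟨a' + (a'.natAbs + (c 0).natAbs + 1 : ℕ), fun N hN => ?_⟩
  obtain ⟨n, hn⟩ : ∃ n : ℕ, (N : ℤ) = a' + n := ⟨(N - a').toNat, by omega⟩
  have p2 := pathIn_compl_singleton_ray c s n a' b' i' hg
  rw [← hn] at p2
  have hNc : N ≠ c 0 := by omega
  have hm : ∀ y : ℤ, ∀ j : Fin 2,
      ((![N, y] : Site 2), j) ∈ ((↑({(c, s)} : Finset HexVertex) : Set HexVertex))ᶜ :=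
    fun y j => mem_compl_singleton_of_ne c s N y j hNc
  have p3 : PathIn hexGraph ((↑({(c, s)} : Finset HexVertex) : Set HexVertex))ᶜ
      (![N, b'], i') (![N, b'], 0) := by
    fin_cases i'
    · exact PathIn.refl (hm _ _)
    · exact (PathIn.refl (hm _ _)).tail (hexGraph_adj_up N b').symm (hm _ _)
  have p4 : PathIn hexGraph ((↑({(c, s)} : Finset HexVertex) : Set HexVertex))ᶜ
      (![N, b'], 0) (![N, 0], 0) := by
    rcases le_or_gt 0 b' with hb | hb
    · obtain ⟨k, hk⟩ : ∃ k : ℕ, b' = 0 + k := ⟨b'.toNat, by omega⟩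
      have := (pathIn_compl_singleton_vertical c s N hNc k 0).1
      rw [← hk] at this; exact this
    · obtain ⟨k, hk⟩ : ∃ k : ℕ, b' = 0 - k := ⟨(-b').toNat, by omega⟩
      have := (pathIn_compl_singleton_vertical c s N hNc k 0).2
      rw [← hk] at this; exact this
  exact ((p1.trans p2).trans p3).trans p4

/-- Any two vertices of the complement of `{(c; s)}` are joined inside it. [folklore] -/
theorem pathIn_compl_singleton (p q : HexVertex)
    (hp : p ∈ ((↑({(c, s)} : Finset HexVertex) : Set HexVertex))ᶜ)
    (hq : q ∈ ((↑({(c, s)} : Finset HexVertex) : Set HexVertex))ᶜ) :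
    PathIn hexGraph ((↑({(c, s)} : Finset HexVertex) : Set HexVertex))ᶜ p q := by
  obtain ⟨x, i⟩ := p
  obtain ⟨y, j⟩ := q
  have hx : x = ![x 0, x 1] := by funext k; fin_cases k <;> rfl
  have hy : y = ![y 0, y 1] := by funext k; fin_cases k <;> rfl
  rw [hx] at hp ⊢
  rw [hy] at hq ⊢
  obtain ⟨B₁, h₁⟩ := pathIn_compl_singleton_to_hub c s (x 0) (x 1) i hp
  obtain ⟨B₂, h₂⟩ := pathIn_compl_singleton_to_hub c s (y 0) (y 1) j hq
  exact (h₁ (max B₁ B₂) (le_max_left _ _)).trans (h₂ (max B₁ B₂) (le_max_right _ _)).symm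

end Singleton

/-- **Every one-vertex domain of the hexagonal lattice is simply connected** ("having a connected
complement", `hexDomainSimplyConnected`): the subgraph of `ℍ` induced on the complement of a
vertex is preconnected. [folklore] -/
theorem hexDomainSimplyConnected_singleton (v : HexVertex) :
    hexDomainSimplyConnected ({v} : Finset HexVertex) := by
  obtain ⟨c, s⟩ := v
  exact preconnected_induce_of_forall_pathIn fun x hx y hy => pathIn_compl_singleton c s x y hx hy

/-! ### The minimal distance between vertices of `ℍ` -/

/-- The difference of two face centres in terms of `ζ`: `c(x;i) - c(y;j) = ((x₀-y₀) + (i-j)/3) +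
((x₁-y₁) + (i-j)/3) ζ`. [folklore] -/
theorem hexCenter_sub_hexCenter (x y : Site 2) (i j : Fin 2) :
    hexCenter (x, i) - hexCenter (y, j) =
      (((x 0 - y 0 : ℤ) : ℝ) + ((i : ℕ) - (j : ℕ) : ℝ) / 3 : ℝ) +
        ((((x 1 - y 1 : ℤ) : ℝ) + ((i : ℕ) - (j : ℕ) : ℝ) / 3 : ℝ) : ℂ) * triZeta := by
  simp only [hexCenter, triEmbed]
  push_cast
  ring

/-- **Distinct vertices of the hexagonal lattice are at distance `≥ 1/√3`** (the edge length of
the honeycomb dual to the unit triangular lattice): on each sublattice pair the squared distance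
is the quadratic form `a² + ab + b²` of `𝕋` at a point of `ℤ²`, `ℤ² + (1/3,1/3)` or
`ℤ² - (1/3,1/3)`, which is `≥ 1`, `≥ 1/3`, `≥ 1/3` respectively unless the two vertices coincide.
[folklore] -/
theorem inv_sqrt_three_le_dist_hexCenter {w v : HexVertex} (hw : w ≠ v) :
    (Real.sqrt 3)⁻¹ ≤ dist (hexCenter w) (hexCenter v) := by
  obtain ⟨x, i⟩ := w
  obtain ⟨y, j⟩ := v
  have h3 : (0 : ℝ) < Real.sqrt 3 := Real.sqrt_pos.2 (by norm_num)
  have hsq : ((Real.sqrt 3)⁻¹) ^ 2 = 3⁻¹ := by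
    rw [inv_pow, Real.sq_sqrt (by norm_num : (0 : ℝ) ≤ 3)]
  -- the integer quadratic form bounds
  have qf_pos : ∀ d₀ d₁ : ℤ, (d₀ ≠ 0 ∨ d₁ ≠ 0) → (1 : ℤ) ≤ d₀ ^ 2 + d₀ * d₁ + d₁ ^ 2 := by
    intro d₀ d₁ hd
    have hpos : (0 : ℤ) < d₀ ^ 2 + d₀ * d₁ + d₁ ^ 2 := by
      rcases hd with h | h
      · nlinarith [sq_nonneg (d₀ + d₁), sq_nonneg d₁, sq_pos_of_ne_zero h]
      · nlinarith [sq_nonneg (d₀ + d₁), sq_nonneg d₀, sq_pos_of_ne_zero h]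
    linarith [Int.lt_iff_add_one_le.mp hpos]
  have qf_shift : ∀ d₀ d₁ : ℤ, (0 : ℤ) ≤ d₀ ^ 2 + d₀ * d₁ + d₁ ^ 2 + d₀ + d₁ := by
    intro d₀ d₁
    have h2 : (0 : ℤ) ≤ 2 * (d₀ ^ 2 + d₀ * d₁ + d₁ ^ 2 + d₀ + d₁) + 1 := by
      nlinarith [sq_nonneg (d₀ + d₁ + 1), sq_nonneg d₀, sq_nonneg d₁]
    generalize hq : d₀ ^ 2 + d₀ * d₁ + d₁ ^ 2 + d₀ + d₁ = q at h2 ⊢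
    omega
  have key : (3 : ℝ)⁻¹ ≤ Complex.normSq (hexCenter (x, i) - hexCenter (y, j)) := by
    rw [hexCenter_sub_hexCenter, normSq_add_mul_triZeta]
    set d₀ : ℤ := x 0 - y 0 with hd₀
    set d₁ : ℤ := x 1 - y 1 with hd₁
    fin_cases i <;> fin_cases j
    · -- same sublattice (up/up): integer point, non-zero
      have hd : d₀ ≠ 0 ∨ d₁ ≠ 0 := by
        by_contra hcon
        rw [not_or, not_not, not_not] at hcon
        apply hw
        have hxy : x = y := by
          funext k; fin_cases k
          · show x 0 = y 0; omega
          · show x 1 = y 1; omega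
        rw [hxy]
      have h1 : (1 : ℝ) ≤ (d₀ : ℝ) ^ 2 + (d₀ : ℝ) * d₁ + (d₁ : ℝ) ^ 2 := by exact_mod_cast qf_pos d₀ d₁ hd
      simp only [Nat.cast_zero, sub_zero, zero_div, add_zero]
      linarith [show (3 : ℝ)⁻¹ ≤ 1 by norm_num]
    · -- up minus down: shift by -1/3
      have h1 : (0 : ℝ) ≤ (d₀ : ℝ) ^ 2 + (d₀ : ℝ) * d₁ + (d₁ : ℝ) ^ 2 + (-d₀ : ℝ) + (-d₁ : ℝ) := by
        have := qf_shift (-d₀) (-d₁)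
        have h' : (0 : ℝ) ≤ ((-d₀ : ℤ) : ℝ) ^ 2 + ((-d₀ : ℤ) : ℝ) * ((-d₁ : ℤ) : ℝ) + ((-d₁ : ℤ) : ℝ) ^ 2
            + ((-d₀ : ℤ) : ℝ) + ((-d₁ : ℤ) : ℝ) := by exact_mod_cast this
        push_cast at h'
        nlinarith [h']
      simp only [Nat.cast_zero, Nat.cast_one, zero_sub]
      nlinarith [h1]
    · -- down minus up: shift by +1/3
      have h1 : (0 : ℝ) ≤ (d₀ : ℝ) ^ 2 + (d₀ : ℝ) * d₁ + (d₁ : ℝ) ^ 2 + d₀ + d₁ := by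
        exact_mod_cast qf_shift d₀ d₁
      simp only [Nat.cast_zero, Nat.cast_one, sub_zero]
      nlinarith [h1]
    · -- same sublattice (down/down)
      have hd : d₀ ≠ 0 ∨ d₁ ≠ 0 := by
        by_contra hcon
        rw [not_or, not_not, not_not] at hcon
        apply hw
        have hxy : x = y := by
          funext k; fin_cases k
          · show x 0 = y 0; omega
          · show x 1 = y 1; omega
        rw [hxy]
      have h1 : (1 : ℝ) ≤ (d₀ : ℝ) ^ 2 + (d₀ : ℝ) * d₁ + (d₁ : ℝ) ^ 2 := by exact_mod_cast qf_pos d₀ d₁ hd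
      simp only [Nat.cast_one, sub_self, zero_div, add_zero]
      linarith [show (3 : ℝ)⁻¹ ≤ 1 by norm_num]
  rw [dist_eq_norm]
  have hn : (3 : ℝ)⁻¹ ≤ ‖hexCenter (x, i) - hexCenter (y, j)‖ ^ 2 := by
    rw [Complex.sq_norm]; exact key
  nlinarith [norm_nonneg (hexCenter (x, i) - hexCenter (y, j)), hsq, inv_pos.2 h3]

/-- In particular adjacent vertices realise the minimum: the `R`-ball of lattice vertices around
`v` is `{v}` exactly when `R < 1/√3` (used to read the depth hypothesis of lattice statements
quantified as `∀ w, dist (hexCenter w) (hexCenter v) ≤ R → w ∈ Λ`). [folklore] -/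
theorem eq_of_dist_hexCenter_lt {w v : HexVertex} (h : dist (hexCenter w) (hexCenter v) < (Real.sqrt 3)⁻¹) :
    w = v := by
  by_contra hne
  exact absurd h (not_lt.2 (inv_sqrt_three_le_dist_hexCenter hne))

end Literature.Probability.RandomPlanarGeometry.SAW
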